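import Mathlib
import HarnessLib
import Summits.NavierStokesRegularity.NavierStokesRegularity.Theorems.HalfSpaceWindowDoorCirculationCarryingRigidityGaussAxisAverage

/-!
# Route `HalfSpaceWindowDoor`, crux `CirculationCarryingRigidity` (stmt-NavierStokesRegularity-25311) — line «gauss-swirl»:
# ε-GOOD AXES ARE UNIFORMLY DENSE IN SPACE (quantitative form of «inflow is never uniform over axis positions»)

LEAD ns-hsw-p1 g6 (cell pub-ns-dss), `--supports 25311 --as helper`; own text.

`…GaussAxisAverage.exists_axis_gaussInflow_ge` says that at every time `s`, scale `t` and tolerance `ε` SOME axis position `x₀` has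
Gaussian inflow correlation `ℐ(t; x₀)[v(s)] ≥ −ε`.  Here the axis-averaging law is localised: about ANY centre `xc`, at a scale `T` with
`(t/(t+T))²·sup|ℐ(t+T;·)| ≤ ε/4`, the Gaussian axis-average of `ℐ(t;·)` is `≥ −ε/4`; if `ℐ < −ε` on the whole ball `B(xc, ρ)` then,
with the bound `ℐ ≤ K' = (4π)^{3/2}·12C²·t/(−s)` off the ball and the Chebyshev tail `∫_{|x₀−xc|>ρ} G_T ≤ 6T/ρ²`
(`integral_heatKernel_compl_ball_le`), the average is `≤ −ε + (ε + K')·6T/ρ² ≤ −3ε/4` once `ρ² ≥ 24T(ε+K')/ε` — contradiction.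

* `integral_heatKernel_compl_ball_le` — Gaussian tail by Chebyshev: `∫_{B(xc,ρ)ᶜ} G_T(x₀ − xc)dx₀ ≤ 6T/ρ²`;
* `exists_near_axis_gaussInflow_ge` — **ε-GOOD AXES ARE ρ-DENSE**: for every door-class profile, `s < 0`, `t > 0`, `ε > 0` there is
  `ρ = ρ(C,t,s,ε) > 0` such that EVERY ball of radius `ρ` contains an axis position `x₀` with `ℐ(t; x₀)[v(s)] ≥ −ε`
  (explicitly `T = 4K't/ε + t`, `ρ = √(24T(ε+K')/ε) + 1`).  Census reading: the research statement K1 (`PersistentAxis` ⟺ W6) cannot fail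
  for lack of good axes anywhere in space at any time — only for lack of ONE axis that stays good along a far-past ray.

WHAT THIS IS NOT: not a statement about Navier–Stokes regularity (Clay A); door statements are regularity CRITERIA about HYPOTHETICAL
blow-up profiles; K1 / W6 / item 25311 remain OPEN.
-/

noncomputable section

-- the summit and its single sub-problem share the name (CONVENTIONS §1), as in every Theorems file
set_option linter.dupNamespace false

namespace Summit.NavierStokesRegularity.NavierStokesRegularity.Theorems.HalfSpaceWindowDoorCirculationCarryingRigidityGaussGoodAxes

open scoped BigOperators Topology InnerProductSpace RealInnerProductSpace
open Filter Set Function MeasureTheory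
open Literature.Analysis Literature.Analysis.FluidPDE Literature.Analysis.UnboundedOperators
open Summit.NavierStokesRegularity.NavierStokesRegularity.Theorems.HalfSpaceWindowDoorCirculationCarryingRigidityDefs
open Summit.NavierStokesRegularity.NavierStokesRegularity.Theorems.HalfSpaceWindowDoorCirculationCarryingRigidityGaussKernel
open Summit.NavierStokesRegularity.NavierStokesRegularity.Theorems.HalfSpaceWindowDoorCirculationCarryingRigidityGaussTilting
  (abs_gaussInflow_le integral_norm_sq_mul_heatKernel_E3)
open Summit.NavierStokesRegularity.NavierStokesRegularity.Theorems.HalfSpaceWindowDoorCirculationCarryingRigidityGaussAxisAverage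

/-! ### The Gaussian tail and the density of good axes -/

/-- **Gaussian tail by Chebyshev**: the Gaussian mass outside the ball of radius `ρ` about the centre is `≤ 6T/ρ²`. -/
theorem integral_heatKernel_compl_ball_le {T ρ : ℝ} (hT : 0 < T) (hρ : 0 < ρ) (xc : EuclideanSpace ℝ (Fin 3)) :
    ∫ x₀ in (Metric.closedBall xc ρ)ᶜ, heatKernel T (x₀ - xc) ≤ 6 * T / ρ ^ 2 := by
  have hmeas : MeasurableSet (Metric.closedBall xc ρ)ᶜ := measurableSet_closedBall.compl
  have hI2 : Integrable fun x₀ : EuclideanSpace ℝ (Fin 3) => ‖x₀ - xc‖ ^ 2 * heatKernel T (x₀ - xc) :=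
    integrable_norm_sq_mul_G xc hT
  have hG : Integrable fun x₀ : EuclideanSpace ℝ (Fin 3) => heatKernel T (x₀ - xc) := integrable_G xc hT
  -- `ρ² G ≤ ‖x₀ − xc‖² G` outside the ball
  have h1 : ∫ x₀ in (Metric.closedBall xc ρ)ᶜ, ρ ^ 2 * heatKernel T (x₀ - xc) ≤
      ∫ x₀ in (Metric.closedBall xc ρ)ᶜ, ‖x₀ - xc‖ ^ 2 * heatKernel T (x₀ - xc) := by
    refine setIntegral_mono_on (hG.const_mul _).integrableOn hI2.integrableOn hmeas fun x₀ hx₀ => ?_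
    have hG0 : 0 ≤ heatKernel T (x₀ - xc) := (heatKernel_pos hT _).le
    have hd : ρ ≤ ‖x₀ - xc‖ := by
      simp only [mem_compl_iff, Metric.mem_closedBall, dist_eq_norm, not_le] at hx₀
      exact hx₀.le
    have : ρ ^ 2 ≤ ‖x₀ - xc‖ ^ 2 := pow_le_pow_left₀ hρ.le hd 2
    exact mul_le_mul_of_nonneg_right this hG0
  have h2 : ∫ x₀ in (Metric.closedBall xc ρ)ᶜ, ‖x₀ - xc‖ ^ 2 * heatKernel T (x₀ - xc) ≤
      ∫ x₀, ‖x₀ - xc‖ ^ 2 * heatKernel T (x₀ - xc) :=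
    setIntegral_le_integral hI2 (Eventually.of_forall fun x₀ => mul_nonneg (sq_nonneg _) (heatKernel_pos hT _).le)
  have h3 : ∫ x₀ : EuclideanSpace ℝ (Fin 3), ‖x₀ - xc‖ ^ 2 * heatKernel T (x₀ - xc) = 6 * T := by
    rw [integral_sub_right_eq_self (fun y : EuclideanSpace ℝ (Fin 3) => ‖y‖ ^ 2 * heatKernel T y) xc]
    exact integral_norm_sq_mul_heatKernel_E3 hT
  rw [integral_const_mul] at h1
  rw [le_div_iff₀ (by positivity)]
  nlinarith [h1, h2, h3]

set_option maxHeartbeats 400000 in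
/-- **ε-GOOD AXES ARE UNIFORMLY DENSE (door class, no further hypothesis).**  For every profile of the route's Type-I ancient Oseen-mild
class, every time `s < 0`, scale `t > 0` and tolerance `ε > 0` there is a radius `ρ` (depending on `C, t, s, ε` only) such that EVERY
ball of radius `ρ` contains an axis position `x₀` with `ℐ(t; x₀)[v(s)] ≥ −ε`.  (Axis-averaging law about the centre of the ball at a
scale `T` with `(t/(t+T))²·sup|ℐ(t+T)| ≤ ε/4`, the bound `ℐ ≤ (4π)^{3/2}·12C²·t/(−s)` off the ball, and the Chebyshev tail `6T/ρ²`.) -/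
theorem exists_near_axis_gaussInflow_ge {C : ℝ} {v : ℝ → EuclideanSpace ℝ (Fin 3) → EuclideanSpace ℝ (Fin 3)}
    (hv : InDoorClass C v) {t s ε : ℝ} (ht : 0 < t) (hs : s < 0) (hε : 0 < ε) :
    ∃ ρ : ℝ, 0 < ρ ∧ ∀ xc : EuclideanSpace ℝ (Fin 3), ∃ x₀ : EuclideanSpace ℝ (Fin 3),
      ‖x₀ - xc‖ ≤ ρ ∧ -ε ≤ gaussInflow t x₀ (v s) := by
  obtain ⟨hrate, hcont, -, -⟩ := id hv
  have hs0 : 0 < -s := by linarith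
  have hu : Continuous (v s) :=
    hcont.comp_continuous (continuous_const.prodMk continuous_id) fun x => ⟨hs, mem_univ _⟩
  have hB : ∀ x, ‖v s x‖ ≤ C / Real.sqrt (-s) := fun x => hrate s hs x
  -- constants
  set K : ℝ := (4 * Real.pi) ^ ((3 : ℝ) / 2) * (12 * C ^ 2) with hK
  have hK0 : 0 ≤ K := by positivity
  set K' : ℝ := K * (t / (-s)) with hK'
  have hK'0 : 0 ≤ K' := by positivity
  -- scale `T` with `K' t/(t+T) ≤ ε/4`, radius `ρ` with `(ε + K') 6T/ρ² ≤ ε/4`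
  set T : ℝ := 4 * K' * t / ε + t with hT
  have hT0 : 0 < T := by positivity
  have htT : 0 < t + T := by linarith
  set ρ : ℝ := Real.sqrt (24 * T * (ε + K') / ε) + 1 with hρ
  have hρ0 : 0 < ρ := by positivity
  refine ⟨ρ, hρ0, fun xc => ?_⟩
  by_contra hcon
  push Not at hcon
  -- (1) lower bound of the axis average from the law
  have hlaw := integral_heatKernel_mul_gaussInflow hu hB ht hT0 xc
  have hbd := abs_gaussInflow_le hv xc htT hs
  have hlow : -(ε / 4) ≤ ∫ x₀ : EuclideanSpace ℝ (Fin 3), heatKernel T (x₀ - xc) * gaussInflow t x₀ (v s) := by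
    rw [hlaw]
    have h1 : -(K * ((t + T) / (-s))) ≤ gaussInflow (t + T) xc (v s) := by
      have := (abs_le.1 hbd).1
      rw [hK]
      exact this
    have h2 : (t / (t + T)) ^ 2 * (K * ((t + T) / (-s))) ≤ ε / 4 := by
      have hTge : 4 * K' * t / ε ≤ T := by rw [hT]; linarith
      have h3 : (t / (t + T)) ^ 2 * (K * ((t + T) / (-s))) = K' * t / (t + T) := by
        rw [hK']
        field_simp
      rw [h3, div_le_iff₀ htT]
      have h5 : 4 * K' * t ≤ T * ε := (div_le_iff₀ hε).1 hTge
      nlinarith [mul_pos hε ht]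
    nlinarith [h1, h2, sq_nonneg (t / (t + T))]
  -- (2) upper bound by splitting ball / complement
  have hI := integrable_heatKernel_mul_gaussInflow hu hB ht hT0 xc
  have hG := integrable_G xc hT0
  have hball : MeasurableSet (Metric.closedBall xc ρ) := measurableSet_closedBall
  set m : ℝ := ∫ x₀ in (Metric.closedBall xc ρ)ᶜ, heatKernel T (x₀ - xc) with hm
  have hm0 : 0 ≤ m := setIntegral_nonneg hball.compl fun x₀ _ => (heatKernel_pos hT0 _).le
  have hmle : m ≤ 6 * T / ρ ^ 2 := integral_heatKernel_compl_ball_le hT0 hρ0 xc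
  have hone : ∫ x₀ : EuclideanSpace ℝ (Fin 3), heatKernel T (x₀ - xc) = 1 := by
    rw [integral_sub_right_eq_self (fun y : EuclideanSpace ℝ (Fin 3) => heatKernel T y) xc]
    exact integral_heatKernel_eq_one_holds hT0
  have hsplitG : (∫ x₀ in Metric.closedBall xc ρ, heatKernel T (x₀ - xc)) = 1 - m := by
    have := integral_add_compl hball hG
    linarith
  -- on the ball: `ℐ < −ε`; off the ball: `ℐ ≤ K'`
  have hin : ∫ x₀ in Metric.closedBall xc ρ, heatKernel T (x₀ - xc) * gaussInflow t x₀ (v s) ≤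
      ∫ x₀ in Metric.closedBall xc ρ, -ε * heatKernel T (x₀ - xc) := by
    refine setIntegral_mono_on hI.integrableOn (hG.const_mul _).integrableOn hball fun x₀ hx₀ => ?_
    have hGT : 0 ≤ heatKernel T (x₀ - xc) := (heatKernel_pos hT0 _).le
    have hd : ‖x₀ - xc‖ ≤ ρ := by rwa [Metric.mem_closedBall, dist_eq_norm] at hx₀
    have := (hcon x₀ hd).le
    nlinarith
  have hout : ∫ x₀ in (Metric.closedBall xc ρ)ᶜ, heatKernel T (x₀ - xc) * gaussInflow t x₀ (v s) ≤
      ∫ x₀ in (Metric.closedBall xc ρ)ᶜ, K' * heatKernel T (x₀ - xc) := by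
    refine setIntegral_mono_on hI.integrableOn (hG.const_mul _).integrableOn hball.compl fun x₀ _ => ?_
    have hGT : 0 ≤ heatKernel T (x₀ - xc) := (heatKernel_pos hT0 _).le
    have hup : gaussInflow t x₀ (v s) ≤ K' := by
      have := (abs_le.1 (abs_gaussInflow_le hv x₀ ht hs)).2
      rw [hK', hK]
      exact this
    nlinarith
  rw [integral_const_mul, hsplitG] at hin
  rw [integral_const_mul] at hout
  have hsplit := integral_add_compl hball hI
  -- combine: avg ≤ −ε(1−m) + K' m ≤ −ε + (ε+K')·6T/ρ² ≤ −ε + ε/4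
  have hρ2 : 24 * T * (ε + K') / ε ≤ ρ ^ 2 := by
    have hsq : Real.sqrt (24 * T * (ε + K') / ε) ^ 2 = 24 * T * (ε + K') / ε := Real.sq_sqrt (by positivity)
    have hs0' : 0 ≤ Real.sqrt (24 * T * (ε + K') / ε) := Real.sqrt_nonneg _
    rw [hρ]; nlinarith
  have htail : (ε + K') * m ≤ ε / 4 := by
    have h1 : (ε + K') * m ≤ (ε + K') * (6 * T / ρ ^ 2) := mul_le_mul_of_nonneg_left hmle (by positivity)
    have h2 : (ε + K') * (6 * T / ρ ^ 2) ≤ ε / 4 := by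
      rw [mul_div_assoc', div_le_iff₀ (by positivity)]
      rw [div_le_iff₀ hε] at hρ2
      nlinarith
    linarith
  have hup' : ∫ x₀ : EuclideanSpace ℝ (Fin 3), heatKernel T (x₀ - xc) * gaussInflow t x₀ (v s) ≤ -ε + (ε + K') * m := by
    linarith [hsplit, hin, hout]
  linarith

end Summit.NavierStokesRegularity.NavierStokesRegularity.Theorems.HalfSpaceWindowDoorCirculationCarryingRigidityGaussGoodAxes

end
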